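import Literature.Combinatorics.Sahi2008.Symmetry
import HarnessLib

/-!
# `NoHeavyLowerTail` (stmt-CriticalPhenomena-4575) — the free-slot density of Sahi's `E_{n+1}` at EVERY order

Support file, seat `prim-l12-p5` (gen 18), `--supports stmt-CriticalPhenomena-4575`.  Standard axioms, no sorries, no named facts.
For ANY finite weight `μ`, any `f` and any functions `g_0,…,g_{n−1}`:
`E_{n+1}(f; g_0,…,g_{n−1}) = E[f · Z_n(g)]` where the **free-slot density** `Z_n(g)` is defined by the unrolled Lieb–Sahi
recursion `Z_0 = 1`, `Z_{n+1}(g) = Σ_i g_i · Z_n(g without slot i) − E_{n+1}(g)` (`sahiE_cons_eq_ex_mul_zDen`); in closed form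
`Z_n(g) = n!·Π_j g_j − Σ_{V ⊊ [n]} |V|!·E_{n−|V|}(g off V)·Π_{j∈V} g_j` (memo FROM-prim-l12-p5-g18-TOP-PEELING §0 (Z)).
This generalises the order-4 expansion `sahiE_four_eq_ex_mul_Z` (gen 17, `…SahiFreeSlotCells`) used in the free-slot region
reduction, and is the entry point of every order-`≥ 5` free-slot argument: `E_{n+1}(1_X; g) ≥ 0` for all up-sets `X` says that the
signed measure `Z_n(g)·μ` is nonnegative on up-sets.  Also: `E[Z_n(g)] = (n−1)·E_n(g)` for a probability weight (branching).
[this work; cite: LiebSahi2021, Prop. 3.3 and Def. 3.1; Sahi2008, Thm. 6]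
-/

namespace Summit.CriticalPhenomena.PercolationContinuityZ3.Theorems

namespace SahiFreeSlot

open Finset Literature.Combinatorics.Sahi2008

variable {α : Type*} [Fintype α]

/-- **Free-slot density** `Z_n(g)` of Sahi's `E_{n+1}` with the free function in slot `0`:
`Z_0 = 1`, `Z_{n+1}(g)(ω) = Σ_i g_i(ω)·Z_n(g ∘ i.succAbove)(ω) − E_{n+1}(g)` (the Lieb–Sahi recursion unrolled on the
free slot). [this work; cite: LiebSahi2021, Prop. 3.3] -/
noncomputable def zDen (μ : α → ℝ) : (n : ℕ) → (Fin n → α → ℝ) → α → ℝ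
  | 0, _ => fun _ => 1
  | n + 1, g => fun ω => (∑ i : Fin (n + 1), g i ω * zDen μ n (fun j => g (i.succAbove j)) ω) - sahiE μ (n + 1) g

/-- `Z_0 = 1`. [this work] -/
theorem zDen_zero (μ : α → ℝ) (g : Fin 0 → α → ℝ) (ω : α) : zDen μ 0 g ω = 1 := rfl

/-- The defining recursion of `Z_{n+1}`. [this work; cite: LiebSahi2021, Prop. 3.3] -/
theorem zDen_succ (μ : α → ℝ) (n : ℕ) (g : Fin (n + 1) → α → ℝ) (ω : α) :
    zDen μ (n + 1) g ω = (∑ i : Fin (n + 1), g i ω * zDen μ n (fun j => g (i.succAbove j)) ω) - sahiE μ (n + 1) g := rfl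

/-- Multiplying slot `i` by `f` and moving it to the front does not change `E_{n+1}` (symmetry of `E`):
`E_{n+1}(g with g_i ↦ g_i f) = E_{n+1}(g_i f, g ∘ i.succAbove)`. [folklore; cite: LiebSahi2021, Def. 3.1] -/
theorem sahiE_update_mul_eq_cons (μ : α → ℝ) (n : ℕ) (f : α → ℝ) (g : Fin (n + 1) → α → ℝ) (i : Fin (n + 1)) :
    sahiE μ (n + 1) (Function.update g i (g i * f)) =
      sahiE μ (n + 1) (Fin.cons (g i * f) (fun j => g (i.succAbove j)) : Fin (n + 1) → α → ℝ) := by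
  have h : Function.update g i (g i * f) =
      fun k => (Fin.cons (g i * f) (fun j => g (i.succAbove j)) : Fin (n + 1) → α → ℝ) (i.cycleRange k) := by
    funext k
    rw [Fin.cons_apply_cycleRange]
    change Function.update g i (g i * f) k = i.insertNth (g i * f) (Fin.removeNth i g) k
    rw [Fin.insertNth_removeNth]
  rw [h, sahiE_comp_perm]

/-- **`E_{n+1}(f; g) = E[f · Z_n(g)]`** for every finite weight, every `f` and every `g : Fin n → α → ℝ`.
[this work; cite: LiebSahi2021, Prop. 3.3] -/
theorem sahiE_cons_eq_ex_mul_zDen (μ : α → ℝ) :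
    ∀ (n : ℕ) (f : α → ℝ) (g : Fin n → α → ℝ),
      sahiE μ (n + 1) (Fin.cons f g : Fin (n + 1) → α → ℝ) = ex μ (fun ω => f ω * zDen μ n g ω)
  | 0, f, g => by
    simp only [zDen_zero, mul_one]
    rfl
  | n + 1, f, g => by
    rw [sahiE_fin_cons]
    have hsum : ∀ i : Fin (n + 1), sahiE μ (n + 1) (Function.update g i (g i * f)) =
        ex μ (fun ω => (g i ω * f ω) * zDen μ n (fun j => g (i.succAbove j)) ω) := by
      intro i
      rw [sahiE_update_mul_eq_cons, sahiE_cons_eq_ex_mul_zDen μ n]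
      rfl
    simp only [hsum]
    simp only [zDen_succ, ex, mul_sub, mul_sum, Finset.sum_sub_distrib]
    rw [Finset.sum_comm]
    congr 1
    · refine Finset.sum_congr rfl fun i _ => Finset.sum_congr rfl fun ω _ => ?_
      ring
    · refine Finset.sum_congr rfl fun ω _ => ?_
      ring

/-- The same in `Matrix.vecCons` form (how families are written with `![…]`). [this work] -/
theorem sahiE_vecCons_eq_ex_mul_zDen (μ : α → ℝ) (n : ℕ) (f : α → ℝ) (g : Fin n → α → ℝ) :
    sahiE μ (n + 1) (Matrix.vecCons f g) = ex μ (fun ω => f ω * zDen μ n g ω) :=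
  sahiE_cons_eq_ex_mul_zDen μ n f g

/-- **Total mass of the density**: `E[Z_n(g)] = (n−1)·E_n(g)` for a probability weight (`n ≥ 1`; Sahi's branching
`E_{n+1}(1; g) = (n−1)E_n(g)`). [this work; cite: Sahi2008, Thm. 6] -/
theorem ex_zDen {μ : α → ℝ} (hμ : ∑ x, μ x = 1) (n : ℕ) (g : Fin (n + 1) → α → ℝ) :
    ex μ (zDen μ (n + 1) g) = n * sahiE μ (n + 1) g := by
  have h := sahiE_cons_eq_ex_mul_zDen μ (n + 1) 1 g
  simp only [Pi.one_apply, one_mul] at h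
  rw [← sahiE_one_cons hμ n g]
  rw [show (Matrix.vecCons 1 g : Fin (n + 2) → α → ℝ) = Fin.cons 1 g from rfl, h]

/-- **Free-slot positivity as a statement about the density** (the form used by the region reduction): if
`E[1_X · Z_n(g)] ≥ 0` for an event `X`, then `E_{n+1}(1_X; g) ≥ 0`. [this work] -/
theorem sahiE_cons_indicator_nonneg_of_density (μ : α → ℝ) (n : ℕ) (X : Set α) [DecidablePred (· ∈ X)]
    (g : Fin n → α → ℝ)
    (h : 0 ≤ ex μ (fun ω => (if ω ∈ X then (1 : ℝ) else 0) * zDen μ n g ω)) :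
    0 ≤ sahiE μ (n + 1) (Fin.cons (fun ω => if ω ∈ X then (1 : ℝ) else 0) g : Fin (n + 1) → α → ℝ) := by
  rwa [sahiE_cons_eq_ex_mul_zDen]

/-- **`Z_n(g)` is pattern-measurable**: its value at `ω` depends only on the vector `(g_j(ω))_j` (so `Z_n(g)·μ` is a signed
measure on the cells of any map through which the `g_j` factor — the cell decomposition of the free-slot region reduction at
every order). [this work] -/
theorem zDen_congr_point (μ : α → ℝ) :
    ∀ (n : ℕ) (g : Fin n → α → ℝ) (ω ω' : α), (∀ j, g j ω = g j ω') → zDen μ n g ω = zDen μ n g ω'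
  | 0, g, ω, ω', _ => rfl
  | n + 1, g, ω, ω', h => by
    simp only [zDen_succ]
    refine congrArg (· - sahiE μ (n + 1) g) (Finset.sum_congr rfl fun i _ => ?_)
    rw [h i, zDen_congr_point μ n (fun j => g (i.succAbove j)) ω ω' (fun j => h (i.succAbove j))]

/-- If every `g_j` factors through a cell map `c : α → N` then so does `Z_n(g)`: `Z_n(g)(ω) = Z_n(g)(ω')` whenever
`c ω = c ω'`. [this work] -/
theorem zDen_eq_of_cellMap (μ : α → ℝ) (n : ℕ) (g : Fin n → α → ℝ) {N : Type*} (c : α → N)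
    (γ : Fin n → N → ℝ) (hg : ∀ j ω, g j ω = γ j (c ω)) {ω ω' : α} (hc : c ω = c ω') :
    zDen μ n g ω = zDen μ n g ω' :=
  zDen_congr_point μ n g ω ω' fun j => by rw [hg, hg, hc]

/-- **Cell decomposition of the free-slot functional at every order**: if the `g_j` factor through `c : α → N` (`N` finite)
then `E_{n+1}(f; g) = Σ_m E[1_{c=m}·Z_n(g)·f]`, and on each fibre `Z_n(g)` is the constant `ζ_m` (`zDen_eq_of_cellMap`) — so
`E_{n+1}(1_X; g) = Σ_m ζ_m · μ(X ∩ {c = m})` (memo §0; gen 17's `sahiE_four_eq_sum_cells` is the order-4 instance). [this work] -/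
theorem sahiE_cons_eq_sum_fibres (μ : α → ℝ) (n : ℕ) (f : α → ℝ) (g : Fin n → α → ℝ) {N : Type*} [Fintype N]
    [DecidableEq N] (c : α → N) :
    sahiE μ (n + 1) (Fin.cons f g : Fin (n + 1) → α → ℝ) =
      ∑ m : N, ex μ (fun ω => (if c ω = m then (1 : ℝ) else 0) * zDen μ n g ω * f ω) := by
  rw [sahiE_cons_eq_ex_mul_zDen]
  simp only [ex]
  rw [Finset.sum_comm]
  refine Finset.sum_congr rfl fun ω _ => ?_
  rw [← Finset.mul_sum]
  congr 1
  rw [Finset.sum_eq_single (c ω)]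
  · simp
    ring
  · intro m _ hm
    simp [Ne.symm hm]
  · intro h
    exact absurd (Finset.mem_univ _) h

/-! ### Closed forms of the density at orders 2–5 (`Z_1 … Z_4`)
The unrolled recursion: `Z_n(g) = n!·Π_j g_j − Σ_{V⊊[n]} |V|!·E_{n−|V|}(g off V)·Π_{j∈V} g_j` (memo FROM-prim-l12-p5-g18-TOP-PEELING §0 (Z)),
written out for `n ≤ 4`; `zDen_four` is the order-5 free-slot density (four hits + one free slot). -/

/-- `Z_1(g) = g₀ − E(g₀)` (order 2 = covariance). [this work] -/
theorem zDen_one (μ : α → ℝ) (g : Fin 1 → α → ℝ) (ω : α) : zDen μ 1 g ω = g 0 ω - ex μ (g 0) := by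
  rw [zDen_succ, Fin.sum_univ_one, zDen_zero, mul_one, sahiE_one_apply]

/-- `Z_2(g) = 2g₀g₁ − E(g₁)g₀ − E(g₀)g₁ − E_2(g)` (order 3). [this work] -/
theorem zDen_two (μ : α → ℝ) (g : Fin 2 → α → ℝ) (ω : α) :
    zDen μ 2 g ω = 2 * (g 0 ω * g 1 ω) - ex μ (g 1) * g 0 ω - ex μ (g 0) * g 1 ω - sahiE μ 2 g := by
  rw [zDen_succ, Fin.sum_univ_two, zDen_one, zDen_one]
  simp only [(show Fin.succAbove (0 : Fin 2) (0 : Fin 1) = 1 from by decide), (show Fin.succAbove (1 : Fin 2) (0 : Fin 1) = 0 from by decide), Nat.reduceAdd]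
  ring

/-- `Z_3(g) = 6g₀g₁g₂ − 2Σ_k E(g_k)·g_ig_j − Σ_j E_2(g_k,g_l)·g_j − E_3(g)` (order 4; = gen 17's `sahiE_four_eq_ex_mul_Z`). [this work] -/
theorem zDen_three (μ : α → ℝ) (g : Fin 3 → α → ℝ) (ω : α) :
    zDen μ 3 g ω = 6 * (g 0 ω * g 1 ω * g 2 ω)
      - 2 * (ex μ (g 0) * (g 1 ω * g 2 ω) + ex μ (g 1) * (g 0 ω * g 2 ω) + ex μ (g 2) * (g 0 ω * g 1 ω))
      - (sahiE μ 2 ![g 1, g 2] * g 0 ω + sahiE μ 2 ![g 0, g 2] * g 1 ω + sahiE μ 2 ![g 0, g 1] * g 2 ω)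
      - sahiE μ 3 g := by
  rw [zDen_succ, Fin.sum_univ_three, zDen_two, zDen_two, zDen_two]
  have c0 : (fun j => g (Fin.succAbove (0 : Fin 3) j)) = ![g 1, g 2] := by funext j; fin_cases j <;> rfl
  have c1 : (fun j => g (Fin.succAbove (1 : Fin 3) j)) = ![g 0, g 2] := by funext j; fin_cases j <;> rfl
  have c2 : (fun j => g (Fin.succAbove (2 : Fin 3) j)) = ![g 0, g 1] := by funext j; fin_cases j <;> rfl
  simp only [c0, c1, c2]
  simp only [(show Fin.succAbove (0 : Fin 3) (0 : Fin 2) = 1 from by decide), (show Fin.succAbove (0 : Fin 3) (1 : Fin 2) = 2 from by decide), (show Fin.succAbove (1 : Fin 3) (0 : Fin 2) = 0 from by decide), (show Fin.succAbove (1 : Fin 3) (1 : Fin 2) = 2 from by decide), (show Fin.succAbove (2 : Fin 3) (0 : Fin 2) = 0 from by decide), (show Fin.succAbove (2 : Fin 3) (1 : Fin 2) = 1 from by decide), Nat.reduceAdd]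
  ring

/-- **`Z_4(g)`** (the order-5 free-slot density): `Z_4 = 24·Πg − 6Σ_k E(g_k)Π_{j≠k}g_j − 2Σ_{k<l} E_2(g_i,g_j)·g_kg_l`
`− Σ_j E_3(g without j)·g_j − E_4(g)` (`{i,j}` the complement of `{k,l}`). [this work] -/
theorem zDen_four (μ : α → ℝ) (g : Fin 4 → α → ℝ) (ω : α) :
    zDen μ 4 g ω = 24 * (g 0 ω * g 1 ω * g 2 ω * g 3 ω)
      - 6 * (ex μ (g 0) * (g 1 ω * g 2 ω * g 3 ω) + ex μ (g 1) * (g 0 ω * g 2 ω * g 3 ω)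
             + ex μ (g 2) * (g 0 ω * g 1 ω * g 3 ω) + ex μ (g 3) * (g 0 ω * g 1 ω * g 2 ω))
      - 2 * (sahiE μ 2 ![g 2, g 3] * (g 0 ω * g 1 ω) + sahiE μ 2 ![g 1, g 3] * (g 0 ω * g 2 ω)
             + sahiE μ 2 ![g 1, g 2] * (g 0 ω * g 3 ω) + sahiE μ 2 ![g 0, g 3] * (g 1 ω * g 2 ω)
             + sahiE μ 2 ![g 0, g 2] * (g 1 ω * g 3 ω) + sahiE μ 2 ![g 0, g 1] * (g 2 ω * g 3 ω))
      - (sahiE μ 3 ![g 1, g 2, g 3] * g 0 ω + sahiE μ 3 ![g 0, g 2, g 3] * g 1 ω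
         + sahiE μ 3 ![g 0, g 1, g 3] * g 2 ω + sahiE μ 3 ![g 0, g 1, g 2] * g 3 ω)
      - sahiE μ 4 g := by
  rw [zDen_succ, Fin.sum_univ_four, zDen_three, zDen_three, zDen_three, zDen_three]
  have c0 : (fun j => g (Fin.succAbove (0 : Fin 4) j)) = ![g 1, g 2, g 3] := by funext j; fin_cases j <;> rfl
  have c1 : (fun j => g (Fin.succAbove (1 : Fin 4) j)) = ![g 0, g 2, g 3] := by funext j; fin_cases j <;> rfl
  have c2 : (fun j => g (Fin.succAbove (2 : Fin 4) j)) = ![g 0, g 1, g 3] := by funext j; fin_cases j <;> rfl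
  have c3 : (fun j => g (Fin.succAbove (3 : Fin 4) j)) = ![g 0, g 1, g 2] := by funext j; fin_cases j <;> rfl
  simp only [c0, c1, c2, c3]
  simp only [(show Fin.succAbove (0 : Fin 4) (0 : Fin 3) = 1 from by decide), (show Fin.succAbove (0 : Fin 4) (1 : Fin 3) = 2 from by decide), (show Fin.succAbove (0 : Fin 4) (2 : Fin 3) = 3 from by decide), (show Fin.succAbove (1 : Fin 4) (0 : Fin 3) = 0 from by decide), (show Fin.succAbove (1 : Fin 4) (1 : Fin 3) = 2 from by decide), (show Fin.succAbove (1 : Fin 4) (2 : Fin 3) = 3 from by decide), (show Fin.succAbove (2 : Fin 4) (0 : Fin 3) = 0 from by decide), (show Fin.succAbove (2 : Fin 4) (1 : Fin 3) = 1 from by decide), (show Fin.succAbove (2 : Fin 4) (2 : Fin 3) = 3 from by decide), (show Fin.succAbove (3 : Fin 4) (0 : Fin 3) = 0 from by decide), (show Fin.succAbove (3 : Fin 4) (1 : Fin 3) = 1 from by decide), (show Fin.succAbove (3 : Fin 4) (2 : Fin 3) = 2 from by decide), Nat.reduceAdd]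
  ring

end SahiFreeSlot

end Summit.CriticalPhenomena.PercolationContinuityZ3.Theorems
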